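import Literature.Analysis.Calculus.IteratedFDerivWords      -- ★ p851106 (LH3-p01 (g5)): words in basis letters, Schwarz for words, `inl`-sections
import Mathlib.LinearAlgebra.Basis.Prod
import Literature.Analysis.Calculus.ContDiffBoundedFamilyLpInfty   -- ★ p850983 (LH7-p02 (g4)) (B2a): `exists_contDiff_hasCompactSupport_lpInfty_of_bounds_on` (a `C^∞`-bounded family IS one `ℓ^∞`-valued test function + evaluations)
import HarnessLib

/-!
# Uniform bounds for the joint jets of a BLOCK READER `(q, θ) ↦ Φ(g_q)(θ)` from uniform bounds of its transversal jets over an admissible family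
# (Hörmander, ALPDO I §1.1 Thm. 1.1.8–1.1.9; Harish-Chandra ∕ Varadarajan 1977 I §1.12 bookkeeping; Bouaziz 1994 §3.1 (I₁))

Topic `Analysis/Calculus`; namespace `Literature.Analysis.Calculus`.  THEOREMS ONLY (no `def`, no instance, no notation, no axiom, no named fact, no `sorry`).  Cell `pub/hodgecm-mathlib`,
crux H413 (`stmt-HodgeConjecture-24833`), F0∕P3c line LH3 (leaf `F0_P3c_StubN9Direct` v5, organ O-L1d′ `stub_N9hcCentralMixedJetBounds`), LH3-plan (g4) deal (n1) «O-L1d′ ENGINE — THE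
MIXED-READER INDUCTION» (F0P3a-p08 (g23)); generic layer, group-free.

THE SETTING (= (X3-CORE) §1 of F0P3a-p02 (g21) with the transversal variable in a finite-dimensional BLOCK `V` instead of `ℝ`).  `P` (parameters) and `V` (the transversal block) are
finite-dimensional real normed spaces, `Q ⊆ P`, `T ⊆ V` open; a READER `Φ : (Y → W′) → V → F` turns a test function into a function on the block; `Adm` is a class of parameter families
`g : P → Y → W′` closed under the parameter derivative `D v` (`hcl`), and for admissible `g` the joint function `H_g (q, θ) := Φ (g q) θ` is `C^∞` on `Q ×ˢ T` (`h1`) with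
`∂_{(v,0)} H_g = H_{D v g}` there (`h2`).  MAIN THEOREM **`exists_forall_norm_iteratedFDeriv_blockReader_le_of_uniform_on`**: if for every admissible `g` and every order `a` the TRANSVERSAL jets
`‖D^a[Φ(g_q)](θ)‖` are bounded uniformly on a product region `(S ∩ Q) × (T ∩ T₀)` (`hbd`), then so are ALL joint jets `‖D^k H_g (q, θ)‖` (same region, every `k`).
PROOF = words: ★ `exists_forall_norm_iteratedFDeriv_le_pow_mul_sum_norm_foldr` bounds `‖D^k H_g‖` by finitely many WORDS in the letters of the product basis `b_P ⊕ b_V`; Schwarz for words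
(★ `dirDeriv_foldr_comm_eqOn`) and `h2` push every parameter letter INTO the reader (`foldr_letters_blockReader_eqOn`: `word_l H_g = word_{l|V} H_{D_{l|P} g}` on `Q ×ˢ T`), and a word in
transversal letters only is a word of the SECTION `θ ↦ Φ (g′ q) θ` (§1, the `inr` twins of ★ `foldr_dirDeriv_inl_eq_section`), whose size is read off `hbd`.
The rank-one FACE reader (`V = ℝ`, `T = {sin ψ ≠ 0}`; ★ (X3-CORE) §1 ∕ ★ FILE 2b) and the rank-two CENTRAL reader (`V = Fin 3 → ℝ`, `T` = chamber ∩ ball; ★ (B3-ENGINE)) are two instances of this one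
socket, so a MIXED word (scalar corner at one place, faces at others) is peeled block by block with no second induction.
HONEST LABEL: count-neutral; HC_CM is proved only modulo the 7 printed citations (2 remaining: hLiu418 = stmt-HodgeConjecture-24832, h413 = stmt-HodgeConjecture-24833) until rung 0 closes.

## References
* [HormanderALPDO1] L. Hörmander, *The Analysis of Linear Partial Differential Operators I*, 2nd ed., Springer (1990), §1.1 pp. 7–12, Thm. 1.1.8, Thm. 1.1.9.
* [Varadarajan1977] V. S. Varadarajan, *Harmonic Analysis on Real Reductive Groups*, LNM 576 (1977), Part I §1.12.
* [Bouaziz1994IntegralesOrbitales] A. Bouaziz, *Intégrales orbitales sur les groupes de Lie réductifs*, Ann. Sci. ÉNS 27 (1994), §3.1 (I₁) p. 579.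
-/

set_option autoImplicit false

noncomputable section

open Set Filter Topology Function
open scoped ContDiff ENNReal

namespace Literature.Analysis.Calculus

/-! ## §1 Sections in the SECOND variable: derivatives along `(0, u)` are derivatives of the section `y₂ ↦ g (x₁, y₂)` -/

section SectionSnd

variable {V₁ : Type*} [NormedAddCommGroup V₁] [NormedSpace ℝ V₁] {V₂ : Type*} [NormedAddCommGroup V₂] [NormedSpace ℝ V₂]
  {F : Type*} [NormedAddCommGroup F] [NormedSpace ℝ F]

/-- **`Dg(x₁,x₂)·(0,u) = D[g(x₁,·)](x₂)·u`** for `g` differentiable at `(x₁, x₂)` (chain rule with `y₂ ↦ (x₁, y₂)`, derivative `inr`). [cite: HormanderALPDO1, §1.1 pp. 7–12] -/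
theorem fderiv_apply_inr_eq_fderiv_section {g : V₁ × V₂ → F} {x₁ : V₁} {x₂ : V₂} (hg : DifferentiableAt ℝ g (x₁, x₂)) (u : V₂) :
    fderiv ℝ g (x₁, x₂) (0, u) = fderiv ℝ (fun y₂ => g (x₁, y₂)) x₂ u := by
  have h : HasFDerivAt (fun y₂ => g (x₁, y₂)) ((fderiv ℝ g (x₁, x₂)).comp (ContinuousLinearMap.inr ℝ V₁ V₂)) x₂ :=
    hg.hasFDerivAt.comp x₂ (hasFDerivAt_prodMk_right x₁ x₂)
  rw [h.fderiv, ContinuousLinearMap.comp_apply, ContinuousLinearMap.inr_apply]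

/-- **Words along `(0, u)` are words of the second-variable section**: for `g` `C^∞` on the open `U ⊆ V₁ × V₂` and `x ∈ U`,
`(l.map (0,·)).foldr … g x = l.foldr … (y₂ ↦ g (x.1, y₂)) x.2` (the `inr` twin of ★ `foldr_dirDeriv_inl_eq_section`). [cite: HormanderALPDO1, §1.1 pp. 7–12] -/
theorem foldr_dirDeriv_inr_eq_section {U : Set (V₁ × V₂)} (hU : IsOpen U) {g : V₁ × V₂ → F} (hg : ContDiffOn ℝ ∞ g U) (l : List V₂) :
    ∀ x ∈ U, (l.map fun u => (((0 : V₁), u) : V₁ × V₂)).foldr (fun v h y => fderiv ℝ h y v) g x =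
      l.foldr (fun u h y₂ => fderiv ℝ h y₂ u) (fun y₂ => g (x.1, y₂)) x.2 := by
  induction l with
  | nil => intro x _; simp
  | cons u l ih =>
    rintro ⟨x₁, x₂⟩ hx
    rw [List.map_cons, List.foldr_cons, List.foldr_cons]
    have hsm : ContDiffOn ℝ ∞ ((l.map fun u => (((0 : V₁), u) : V₁ × V₂)).foldr (fun v h y => fderiv ℝ h y v) g) U := contDiffOn_foldr_dirDeriv hU _ hg
    have hd : DifferentiableAt ℝ ((l.map fun u => (((0 : V₁), u) : V₁ × V₂)).foldr (fun v h y => fderiv ℝ h y v) g) (x₁, x₂) :=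
      (hsm.differentiableOn (by simp)).differentiableAt (hU.mem_nhds hx)
    rw [fderiv_apply_inr_eq_fderiv_section hd]
    have hopen : IsOpen {y₂ : V₂ | (x₁, y₂) ∈ U} := hU.preimage (continuous_const.prodMk continuous_id)
    have heq : (fun y₂ => (l.map fun u => (((0 : V₁), u) : V₁ × V₂)).foldr (fun v h y => fderiv ℝ h y v) g (x₁, y₂)) =ᶠ[𝓝 x₂]
        l.foldr (fun u h y₂ => fderiv ℝ h y₂ u) (fun y₂ => g (x₁, y₂)) := by
      filter_upwards [hopen.mem_nhds (show x₂ ∈ {y₂ : V₂ | (x₁, y₂) ∈ U} from hx)] with y₂ hy₂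
      exact ih (x₁, y₂) hy₂
    rw [heq.fderiv_eq]

/-- The section `y₂ ↦ g (x₁, y₂)` of a function `C^∞` on the open `U` is `C^∞` on the open section set `{y₂ | (x₁, y₂) ∈ U}`. [cite: HormanderALPDO1, §1.1 pp. 7–12] -/
theorem contDiffOn_section_snd {U : Set (V₁ × V₂)} {g : V₁ × V₂ → F} (hg : ContDiffOn ℝ ∞ g U) (x₁ : V₁) :
    ContDiffOn ℝ ∞ (fun y₂ => g (x₁, y₂)) {y₂ : V₂ | (x₁, y₂) ∈ U} :=
  hg.comp (contDiff_const.prodMk contDiff_id).contDiffOn fun _ hy => hy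

/-- **JETS OF THE SECOND-VARIABLE SECTION ON TUPLES ARE `(0,·)`-WORDS OF THE JOINT FUNCTION.** [cite: HormanderALPDO1, §1.1 pp. 7–12] -/
theorem iteratedFDeriv_section_snd_apply_eq_foldr {U : Set (V₁ × V₂)} (hU : IsOpen U) {g : V₁ × V₂ → F} (hg : ContDiffOn ℝ ∞ g U) {x₁ : V₁} {x₂ : V₂}
    (hx : (x₁, x₂) ∈ U) {n : ℕ} (v : Fin n → V₂) :
    iteratedFDeriv ℝ n (fun y₂ => g (x₁, y₂)) x₂ v = ((List.ofFn v).map fun u => (((0 : V₁), u) : V₁ × V₂)).foldr (fun w h y => fderiv ℝ h y w) g (x₁, x₂) := by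
  have hopen : IsOpen {y₂ : V₂ | (x₁, y₂) ∈ U} := hU.preimage (continuous_const.prodMk continuous_id)
  rw [iteratedFDeriv_apply_eq_foldr_dirDeriv hopen (contDiffOn_section_snd hg x₁) (show x₂ ∈ {y₂ : V₂ | (x₁, y₂) ∈ U} from hx) v,
    foldr_dirDeriv_inr_eq_section hU hg (List.ofFn v) (x₁, x₂) hx]

/-- **Norm bound**: `‖word_{(0, v)} g (x₁,x₂)‖ ≤ ‖D^n[g(x₁,·)](x₂)‖ · ∏ ‖v i‖` — the size of a transversal word is read off the operator norm of the section's jet.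
[cite: HormanderALPDO1, §1.1 pp. 7–12] -/
theorem norm_foldr_dirDeriv_inr_le {U : Set (V₁ × V₂)} (hU : IsOpen U) {g : V₁ × V₂ → F} (hg : ContDiffOn ℝ ∞ g U) {x₁ : V₁} {x₂ : V₂}
    (hx : (x₁, x₂) ∈ U) {n : ℕ} (v : Fin n → V₂) :
    ‖((List.ofFn v).map fun u => (((0 : V₁), u) : V₁ × V₂)).foldr (fun w h y => fderiv ℝ h y w) g (x₁, x₂)‖ ≤
      ‖iteratedFDeriv ℝ n (fun y₂ => g (x₁, y₂)) x₂‖ * ∏ i, ‖v i‖ := by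
  rw [← iteratedFDeriv_section_snd_apply_eq_foldr hU hg hx v]
  exact ContinuousMultilinearMap.le_opNorm _ _

end SectionSnd

/-! ## §2 The block reader: parameter letters go INTO the reader, transversal letters stay -/

/-- A mapped list is the tuple of its entries (bookkeeping: `l.map f = ofFn (r ↦ f (l.get r))`). [cite: HormanderALPDO1, §1.1 pp. 7–12] -/
theorem map_eq_ofFn_get {α β : Type*} (l : List α) (f : α → β) : l.map f = List.ofFn (fun r : Fin l.length => f (l.get r)) := by
  apply List.ext_getElem (by simp)
  intro i h₁ h₂
  simp

section Reader

variable {P : Type*} [NormedAddCommGroup P] [NormedSpace ℝ P] {V : Type*} [NormedAddCommGroup V] [NormedSpace ℝ V]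
  {F : Type*} [NormedAddCommGroup F] [NormedSpace ℝ F] {Y W' : Type*}

/-- **SORTING A MIXED WORD**: on `Q ×ˢ T`, for an admissible family `g` and a list `l` of LETTERS — parameter letters `inl i ↦ (p i, 0)`, transversal letters `inr j ↦ (0, t j)` — the word
`word_l H_g` of the joint function `H_g (q, θ) = Φ (g q) θ` equals the word IN THE TRANSVERSAL LETTERS ONLY of `H_{g′}`, `g′ = D_{p i₁} ⋯ D_{p i_r} g` the parameter letters of `l`
applied in order (admissible by `hcl`): Schwarz for words on the open set (★ `dirDeriv_foldr_comm_eqOn`) moves each parameter letter innermost, where `h2` turns it into `D (p i)`.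
[cite: HormanderALPDO1, §1.1 Thm. 1.1.8] [cite: Varadarajan1977, I §1.12] -/
theorem foldr_letters_blockReader_eqOn {Q : Set P} (hQ : IsOpen Q) {T : Set V} (hT : IsOpen T) (Φ : (Y → W') → V → F)
    (Adm : (P → Y → W') → Prop) (D : P → (P → Y → W') → (P → Y → W')) (hcl : ∀ g, Adm g → ∀ v, Adm (D v g))
    (h1 : ∀ g, Adm g → ContDiffOn ℝ ∞ (fun z : P × V => Φ (g z.1) z.2) (Q ×ˢ T))
    (h2 : ∀ g, Adm g → ∀ (v : P) (z : P × V), z ∈ Q ×ˢ T → fderiv ℝ (fun z : P × V => Φ (g z.1) z.2) z (v, 0) = Φ (D v g z.1) z.2)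
    {κP κV : Type*} (p : κP → P) (t : κV → V) (l : List (κP ⊕ κV)) :
    ∀ g, Adm g →
      Adm (l.foldr (fun s acc => Sum.elim (fun i => D (p i) acc) (fun _ => acc) s) g) ∧
      EqOn ((l.map (Sum.elim (fun i => ((p i, 0) : P × V)) (fun j => (((0 : P), t j) : P × V)))).foldr (fun v h y => fderiv ℝ h y v)
          (fun z : P × V => Φ (g z.1) z.2))
        (((l.filterMap Sum.getRight?).map fun j => (((0 : P), t j) : P × V)).foldr (fun v h y => fderiv ℝ h y v)
          (fun z : P × V => Φ ((l.foldr (fun s acc => Sum.elim (fun i => D (p i) acc) (fun _ => acc) s) g) z.1) z.2))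
        (Q ×ˢ T) := by
  have hO : IsOpen (Q ×ˢ T) := hQ.prod hT
  induction l with
  | nil => intro g hg; exact ⟨hg, fun z _ => rfl⟩
  | cons s l ih =>
    intro g hg
    obtain ⟨hadm, heq⟩ := ih g hg
    cases s with
    | inl i =>
      refine ⟨hcl _ hadm (p i), ?_⟩
      rw [List.map_cons, List.foldr_cons, List.foldr_cons]
      simp only [Sum.elim_inl, List.filterMap_cons, Sum.getRight?_inl]
      -- `D_{(p i,0)} (word_l H_g) = D_{(p i,0)} (word_{l|V} H_{g_l})` (IH, open set) `= word_{l|V} (D_{(p i,0)} H_{g_l})` (Schwarz) `= word_{l|V} H_{D (p i) g_l}` (`h2`)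
      have step1 := dirDeriv_eqOn_of_eqOn hO heq ((p i, 0) : P × V)
      have step2 := dirDeriv_foldr_comm_eqOn hO ((p i, 0) : P × V) ((l.filterMap Sum.getRight?).map fun j => (((0 : P), t j) : P × V)) (h1 _ hadm)
      have step3 : EqOn (fun z : P × V => fderiv ℝ (fun z : P × V => Φ ((l.foldr (fun s acc => Sum.elim (fun i => D (p i) acc) (fun _ => acc) s) g) z.1) z.2) z ((p i, 0) : P × V))
          (fun z : P × V => Φ ((D (p i) (l.foldr (fun s acc => Sum.elim (fun i => D (p i) acc) (fun _ => acc) s) g)) z.1) z.2) (Q ×ˢ T) :=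
        fun z hz => h2 _ hadm (p i) z hz
      exact (step1.trans step2).trans (foldr_dirDeriv_eqOn_of_eqOn hO _ step3)
    | inr j =>
      refine ⟨hadm, ?_⟩
      rw [List.map_cons, List.foldr_cons]
      simp only [Sum.elim_inr, List.filterMap_cons, Sum.getRight?_inr, List.map_cons, List.foldr_cons]
      exact dirDeriv_eqOn_of_eqOn hO heq (((0 : P), t j) : P × V)

variable [FiniteDimensional ℝ P] [FiniteDimensional ℝ V]

/-- **UNIFORM BOUNDS FOR THE JOINT JETS OF A BLOCK READER FROM UNIFORM BOUNDS OF ITS TRANSVERSAL JETS** ((X3-CORE) §1 with the transversal variable in a finite-dimensional block `V`).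
If for every admissible `g` and every order `a` the transversal jets `‖D^a[Φ(g_q)](θ)‖` are bounded uniformly for `q ∈ S ∩ Q`, `θ ∈ T ∩ T₀` (`hbd`), then for every admissible `g` and
every `k` the JOINT jets `‖D^k[(q,θ) ↦ Φ(g_q)(θ)](q,θ)‖` are bounded uniformly on `(S ∩ Q) ×ˢ (T ∩ T₀)`.  (Basis words ★ `exists_forall_norm_iteratedFDeriv_le_pow_mul_sum_norm_foldr` for the product
basis `b_P ⊕ b_V`; `foldr_letters_blockReader_eqOn`; §1.)  Instances: the face reader (`V = ℝ`), the central reader (`V = Fin 3 → ℝ`, `T` = chamber ∩ ball).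
[cite: HormanderALPDO1, §1.1 Thm. 1.1.8–1.1.9] [cite: Varadarajan1977, I §1.12] [cite: Bouaziz1994IntegralesOrbitales, §3.1 (I₁) p. 579] -/
theorem exists_forall_norm_iteratedFDeriv_blockReader_le_of_uniform_on {Q : Set P} (hQ : IsOpen Q) {T : Set V} (hT : IsOpen T) (Φ : (Y → W') → V → F)
    (Adm : (P → Y → W') → Prop) (D : P → (P → Y → W') → (P → Y → W')) (hcl : ∀ g, Adm g → ∀ v, Adm (D v g))
    (h1 : ∀ g, Adm g → ContDiffOn ℝ ∞ (fun z : P × V => Φ (g z.1) z.2) (Q ×ˢ T))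
    (h2 : ∀ g, Adm g → ∀ (v : P) (z : P × V), z ∈ Q ×ˢ T → fderiv ℝ (fun z : P × V => Φ (g z.1) z.2) z (v, 0) = Φ (D v g z.1) z.2)
    (S : Set P) (T₀ : Set V)
    (hbd : ∀ g, Adm g → ∀ a : ℕ, ∃ B : ℝ, ∀ q ∈ S ∩ Q, ∀ θ ∈ T ∩ T₀, ‖iteratedFDeriv ℝ a (Φ (g q)) θ‖ ≤ B)
    (g : P → Y → W') (hg : Adm g) (k : ℕ) :
    ∃ B : ℝ, ∀ z ∈ (S ∩ Q) ×ˢ (T ∩ T₀), ‖iteratedFDeriv ℝ k (fun z : P × V => Φ (g z.1) z.2) z‖ ≤ B := by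
  have hO : IsOpen (Q ×ˢ T) := hQ.prod hT
  have hsub : (S ∩ Q) ×ˢ (T ∩ T₀) ⊆ Q ×ˢ T := prod_mono inter_subset_right inter_subset_left
  -- the product basis `b_P ⊕ b_V` and its letters
  set bP := Module.finBasis ℝ P with hbP
  set bV := Module.finBasis ℝ V with hbV
  have hletter : ∀ s : Fin (Module.finrank ℝ P) ⊕ Fin (Module.finrank ℝ V),
      (bP.prod bV) s = Sum.elim (fun i => ((bP i, 0) : P × V)) (fun j => (((0 : P), bV j) : P × V)) s := by
    rintro (i | j)
    · exact Prod.ext (Module.Basis.prod_apply_inl_fst bP bV i) (Module.Basis.prod_apply_inl_snd bP bV i)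
    · exact Prod.ext (Module.Basis.prod_apply_inr_fst bP bV j) (Module.Basis.prod_apply_inr_snd bP bV j)
  obtain ⟨C, hC0, hC⟩ := exists_forall_norm_iteratedFDeriv_le_pow_mul_sum_norm_foldr (F := F) (bP.prod bV)
  -- each basis word is bounded uniformly on the region
  have hword : ∀ I : Fin k → Fin (Module.finrank ℝ P) ⊕ Fin (Module.finrank ℝ V), ∃ B : ℝ, ∀ z ∈ (S ∩ Q) ×ˢ (T ∩ T₀),
      ‖(List.ofFn fun r => (bP.prod bV) (I r)).foldr (fun u h y => fderiv ℝ h y u) (fun z : P × V => Φ (g z.1) z.2) z‖ ≤ B := by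
    intro I
    obtain ⟨hadm, heq⟩ := foldr_letters_blockReader_eqOn hQ hT Φ Adm D hcl h1 h2 bP bV (List.ofFn I) g hg
    set g' := (List.ofFn I).foldr (fun s acc => Sum.elim (fun i => D (bP i) acc) (fun _ => acc) s) g with hg'
    set J := (List.ofFn I).filterMap Sum.getRight? with hJ
    obtain ⟨B, hB⟩ := hbd g' hadm J.length
    refine ⟨B * ∏ r : Fin J.length, ‖bV (J.get r)‖, fun z hz => ?_⟩
    obtain ⟨q, θ⟩ := z
    have hzO : (q, θ) ∈ Q ×ˢ T := hsub hz
    have hlist : (List.ofFn fun r => (bP.prod bV) (I r)) =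
        (List.ofFn I).map (Sum.elim (fun i => ((bP i, 0) : P × V)) (fun j => (((0 : P), bV j) : P × V))) := by
      rw [List.map_ofFn]
      exact congrArg List.ofFn (funext fun r => hletter (I r))
    have hJlist : (J.map fun j => (((0 : P), bV j) : P × V)) = ((List.ofFn fun r : Fin J.length => bV (J.get r)).map fun u => (((0 : P), u) : P × V)) := by
      rw [List.map_ofFn, map_eq_ofFn_get]
      rfl
    rw [hlist, heq hzO, hJlist]
    calc ‖((List.ofFn fun r : Fin J.length => bV (J.get r)).map fun u => (((0 : P), u) : P × V)).foldr (fun v h y => fderiv ℝ h y v)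
            (fun z : P × V => Φ (g' z.1) z.2) (q, θ)‖
        ≤ ‖iteratedFDeriv ℝ J.length (fun y₂ => (fun z : P × V => Φ (g' z.1) z.2) (q, y₂)) θ‖ * ∏ r, ‖bV (J.get r)‖ :=
          norm_foldr_dirDeriv_inr_le hO (h1 g' hadm) hzO _
      _ ≤ B * ∏ r, ‖bV (J.get r)‖ :=
          mul_le_mul_of_nonneg_right (hB q hz.1 θ hz.2) (Finset.prod_nonneg fun _ _ => norm_nonneg _)
  choose B hB using hword
  refine ⟨C ^ k * ∑ I, B I, fun z hz => (hC k hO (h1 g hg) (hsub hz)).trans ?_⟩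
  exact mul_le_mul_of_nonneg_left (Finset.sum_le_sum fun I _ => hB I z hz) (pow_nonneg hC0 k)

/-- **The `V = ℝ` edition** (transversal LINE, jets as `iteratedDeriv`): exactly the shape of (X3-CORE) §1 `exists_forall_norm_iteratedFDeriv_reader_le_of_uniform_on` (F0P3a-p02 (g21)) — the
face reader is the one-dimensional instance of the block reader (`‖iteratedFDeriv ℝ a u ψ‖ = ‖iteratedDeriv a u ψ‖`). [cite: HormanderALPDO1, §1.1 Thm. 1.1.8–1.1.9] [cite: Varadarajan1977, I §1.12] -/
theorem exists_forall_norm_iteratedFDeriv_lineReader_le_of_uniform_on {Q : Set P} (hQ : IsOpen Q) {T : Set ℝ} (hT : IsOpen T) (Φ : (Y → W') → ℝ → F)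
    (Adm : (P → Y → W') → Prop) (D : P → (P → Y → W') → (P → Y → W')) (hcl : ∀ g, Adm g → ∀ v, Adm (D v g))
    (h1 : ∀ g, Adm g → ContDiffOn ℝ ∞ (fun z : P × ℝ => Φ (g z.1) z.2) (Q ×ˢ T))
    (h2 : ∀ g, Adm g → ∀ (v : P) (z : P × ℝ), z ∈ Q ×ˢ T → fderiv ℝ (fun z : P × ℝ => Φ (g z.1) z.2) z (v, 0) = Φ (D v g z.1) z.2)
    (S : Set P) (T₀ : Set ℝ)
    (hbd : ∀ g, Adm g → ∀ a : ℕ, ∃ B : ℝ, ∀ q ∈ S ∩ Q, ∀ ψ ∈ T ∩ T₀, ‖iteratedDeriv a (Φ (g q)) ψ‖ ≤ B)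
    (g : P → Y → W') (hg : Adm g) (k : ℕ) :
    ∃ B : ℝ, ∀ z ∈ (S ∩ Q) ×ˢ (T ∩ T₀), ‖iteratedFDeriv ℝ k (fun z : P × ℝ => Φ (g z.1) z.2) z‖ ≤ B :=
  exists_forall_norm_iteratedFDeriv_blockReader_le_of_uniform_on hQ hT Φ Adm D hcl h1 h2 S T₀
    (fun g' hg' a => (hbd g' hg' a).imp fun B hB q hq ψ hψ => by rw [norm_iteratedFDeriv_eq_norm_iteratedDeriv]; exact hB q hq ψ hψ) g hg k

end Reader

/-! ## §3 (E2) The `ℓ^∞` packaging in block form: uniform transversal jet bounds for a `C^∞`-BOUNDED FAMILY from a CLM-uniform bound (= (X3-CORE) §2 with jets on a block `V`) -/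

section BoundedFamilyBlock

variable {M E : Type} [NormedAddCommGroup M] [NormedSpace ℝ M] [NormedAddCommGroup E] [NormedSpace ℝ E]
  {V : Type*} [NormedAddCommGroup V] [NormedSpace ℝ V]

/-- **UNIFORM TRANSVERSAL JET BOUNDS FOR A `C^∞`-BOUNDED FAMILY, BLOCK FORM.**  `F : (M → E) → V → E` any reader, `T₀ ⊆ V`; HYPOTHESIS `hunif`: for every smooth compactly supported
`ℓ^∞(J, E)`-valued test function `G` there is ONE `B` with `‖D^n[F(ℓ ∘ G)](θ)‖ ≤ ‖ℓ‖·B` for all `θ ∈ T₀` and all CLMs `ℓ : ℓ^∞(J,E) →L E` (for the central reader this is ★ p851226 §6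
`exists_forall_norm_iteratedFDeriv_rootProduct_smul_orbital_comp_clm_le`, for the face reader ★ `…orbitalIntegral_cayley_comp_clm_le`); CONCLUSION: every family `(g j)_{j ∈ J}` smooth, supported
in one compact `C` and `C^∞`-bounded there has `‖D^n[F(g j)](θ)‖ ≤ B` uniformly in `j` and `θ ∈ T₀` (★ (B2a): the family is ONE smooth compactly supported `G : M → ℓ^∞(J, E)` and
`g j = ev_j ∘ G`, `‖ev_j‖ ≤ 1`). [cite: HormanderALPDO1, §2.1] [cite: Bouaziz1994IntegralesOrbitales, §3.1 (I₁)–(I₂) p. 579] [cite: Varadarajan1977, I §1.12] -/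
theorem exists_forall_norm_iteratedFDeriv_le_of_uniform_bounds_on {J : Type} (F : (M → E) → V → E) (n : ℕ) (T₀ : Set V)
    (hunif : ∀ G : M → lp (fun _ : J => E) ⊤, ContDiff ℝ ∞ G → HasCompactSupport G →
      ∃ B : ℝ, ∀ θ ∈ T₀, ∀ ℓ : lp (fun _ : J => E) ⊤ →L[ℝ] E, ‖iteratedFDeriv ℝ n (F (fun X => ℓ (G X))) θ‖ ≤ ‖ℓ‖ * B)
    (g : J → M → E) (hg : ∀ j, ContDiff ℝ ∞ (g j)) {C : Set M} (hC : IsCompact C) (hsupp : ∀ j, tsupport (g j) ⊆ C)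
    (hbd : ∀ m : ℕ, ∃ B : ℝ, ∀ j, ∀ X ∈ C, ‖iteratedFDeriv ℝ m (g j) X‖ ≤ B) :
    ∃ B : ℝ, ∀ j, ∀ θ ∈ T₀, ‖iteratedFDeriv ℝ n (F (g j)) θ‖ ≤ B := by
  obtain ⟨G, -, hGs, hGc, -, hev⟩ := exists_contDiff_hasCompactSupport_lpInfty_of_bounds_on g hg hC hsupp hbd
  obtain ⟨B, hB⟩ := hunif G hGs hGc
  refine ⟨max B 0, fun j θ hθ => ?_⟩
  obtain ⟨ℓ, hℓ, hℓG⟩ := hev j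
  have hfun : (fun X => ℓ (G X)) = g j := funext fun X => by rw [hℓG X]
  have h := hB θ hθ ℓ
  rw [hfun] at h
  exact h.trans ((mul_le_mul_of_nonneg_left (le_max_left B 0) (norm_nonneg ℓ)).trans
    (by nlinarith [hℓ, le_max_right B 0, norm_nonneg ℓ]))

/-- **The eventual form along ANY filter `l` on the block** (e.g. `𝓝[chamber] 0`): same proof. [cite: HormanderALPDO1, §2.1] [cite: Bouaziz1994IntegralesOrbitales, §3.1 (I₁)–(I₂) p. 579] -/
theorem exists_forall_eventually_norm_iteratedFDeriv_le_of_uniform_bounds {J : Type} (F : (M → E) → V → E) (n : ℕ) (l : Filter V)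
    (hunif : ∀ G : M → lp (fun _ : J => E) ⊤, ContDiff ℝ ∞ G → HasCompactSupport G →
      ∃ B : ℝ, ∀ᶠ θ in l, ∀ ℓ : lp (fun _ : J => E) ⊤ →L[ℝ] E, ‖iteratedFDeriv ℝ n (F (fun X => ℓ (G X))) θ‖ ≤ ‖ℓ‖ * B)
    (g : J → M → E) (hg : ∀ j, ContDiff ℝ ∞ (g j)) {C : Set M} (hC : IsCompact C) (hsupp : ∀ j, tsupport (g j) ⊆ C)
    (hbd : ∀ m : ℕ, ∃ B : ℝ, ∀ j, ∀ X ∈ C, ‖iteratedFDeriv ℝ m (g j) X‖ ≤ B) :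
    ∃ B : ℝ, ∀ᶠ θ in l, ∀ j, ‖iteratedFDeriv ℝ n (F (g j)) θ‖ ≤ B := by
  obtain ⟨G, -, hGs, hGc, -, hev⟩ := exists_contDiff_hasCompactSupport_lpInfty_of_bounds_on g hg hC hsupp hbd
  obtain ⟨B, hB⟩ := hunif G hGs hGc
  refine ⟨max B 0, ?_⟩
  filter_upwards [hB] with θ hθ j
  obtain ⟨ℓ, hℓ, hℓG⟩ := hev j
  have hfun : (fun X => ℓ (G X)) = g j := funext fun X => by rw [hℓG X]
  have h := hθ ℓ
  rw [hfun] at h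
  exact h.trans ((mul_le_mul_of_nonneg_left (le_max_left B 0) (norm_nonneg ℓ)).trans
    (by nlinarith [hℓ, le_max_right B 0, norm_nonneg ℓ]))

/-- **The `S ∩ Q`-indexed form** — EXACTLY the `hbd` shape of §2 `exists_forall_norm_iteratedFDeriv_blockReader_le_of_uniform_on` for one member and one order: a parameter family
`g′ : P → M → E` whose members over `q ∈ S ∩ Q` are smooth, supported in one compact `C` and `C^∞`-bounded there, and `F` with `hunif` on `T₀` at `ℓ^∞(↥(S ∩ Q), E)`
⇒ `∃ B, ∀ q ∈ S ∩ Q, ∀ θ ∈ T₀, ‖D^n[F(g′ q)](θ)‖ ≤ B`. [cite: HormanderALPDO1, §2.1] [cite: Bouaziz1994IntegralesOrbitales, §3.1 (I₁)–(I₂) p. 579] -/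
theorem exists_forall_norm_iteratedFDeriv_le_of_uniform_bounds_on_inter {P : Type} (F : (M → E) → V → E) (n : ℕ) (S Q : Set P) (T₀ : Set V)
    (hunif : ∀ G : M → lp (fun _ : ↥(S ∩ Q) => E) ⊤, ContDiff ℝ ∞ G → HasCompactSupport G →
      ∃ B : ℝ, ∀ θ ∈ T₀, ∀ ℓ : lp (fun _ : ↥(S ∩ Q) => E) ⊤ →L[ℝ] E, ‖iteratedFDeriv ℝ n (F (fun X => ℓ (G X))) θ‖ ≤ ‖ℓ‖ * B)
    (g' : P → M → E) (hg : ∀ q ∈ S ∩ Q, ContDiff ℝ ∞ (g' q)) {C : Set M} (hC : IsCompact C) (hsupp : ∀ q ∈ S ∩ Q, tsupport (g' q) ⊆ C)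
    (hbd : ∀ m : ℕ, ∃ B : ℝ, ∀ q ∈ S ∩ Q, ∀ X ∈ C, ‖iteratedFDeriv ℝ m (g' q) X‖ ≤ B) :
    ∃ B : ℝ, ∀ q ∈ S ∩ Q, ∀ θ ∈ T₀, ‖iteratedFDeriv ℝ n (F (g' q)) θ‖ ≤ B := by
  obtain ⟨B, hB⟩ := exists_forall_norm_iteratedFDeriv_le_of_uniform_bounds_on (J := ↥(S ∩ Q)) F n T₀ hunif (fun y => g' y.1) (fun y => hg y.1 y.2) hC
    (fun y => hsupp y.1 y.2) (fun m => by obtain ⟨B, hB⟩ := hbd m; exact ⟨B, fun y X hX => hB y.1 y.2 X hX⟩)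
  exact ⟨B, fun q hq θ hθ => hB ⟨q, hq⟩ θ hθ⟩

end BoundedFamilyBlock

end Literature.Analysis.Calculus

end
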